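import Summits.BirchSwinnertonDyer.BirchSwinnertonDyer.Theorems.RamifiedHeegnerPairLeafRankOneUpperAtThreeOfSigma
import Summits.BirchSwinnertonDyer.Rank1Residual.Additive.KodairaDictionaryThree
import Summits.BirchSwinnertonDyer.Rank1Residual.Additive.LocalThreeTorsionIffTamagawaThreeOfIVHolds
import HarnessLib

/-!
# Route `RamifiedHeegnerPair`, crux U₁ `LeafRankOneUpperAtThree` (stmt-BirchSwinnertonDyer-26022), line `splitkolyvagin` —
# the CARRIER SPLIT of the open core Σ: on the MONO-MULTIPLICATIVE-CARRIER rows Σ is the D-audited Jetchev reading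
# (cell `bsd-potss`, crux 20165's S2 binder) INSTANTIATED on the leaf; U₁ there ⟸ PUB + S2 + L₀

HONEST FRAMING. Theorems only; helper file (`--supports stmt-BirchSwinnertonDyer-26022 --as helper`); nothing is booked,
no item is closed, BSD is not proved for any curve; CONDITIONAL on every displayed input. Lead prover bsd-line-rhp-p2 g4,
2026-08-28.

The registered skeleton `Cruxes/LeafRankOneUpperAtThree/Lines/splitkolyvagin.lean` (v2, a7c570fc) cuts U₁ into PUB (print) +
Σ (`stub_leafSigmaDivisibilityAtThree`: Σ-form global `3`-divisibility of the derived Heegner points to depth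
`ord₃ ∏_ℓ c_ℓ(E) + v₃(c)` at the ADDITIVE `3` on the leaf — Jetchev 2008 Conj. 1.3, research) + L₀ (item 26023 BY NAME);
composition = `leafRankOneUpperAtThree_of_pub_of_sigma_of_lowerRankZero` (p610955). Σ is VACUOUS at depth `0`
(p610955 §3: the 9 Tamagawa-free classes). THIS FILE records the next layer of the census in the kernel, following
the carrier split of `ClassRecordThreeEulerHalvesAtThreeJetchevMax` (CR3 at `3 ∥ N`): Jetchev's PRINTED METHOD (Thm. 1.4,
`m_∞ ≥ max_q ord_p c_q`) pays the depth at ONE Tamagawa prime at a time, so on the rows where the whole `3`-part of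
`∏_ℓ c_ℓ(E)` sits at a SINGLE MULTIPLICATIVE prime `q ∥ N` (`ord₃ ∏_ℓ c_ℓ(E) ≤ ord₃ c_q(E)`) and a parametrisation
datum with `3 ∤ c` exists, Σ at that datum IS the divisibility reading of Jetchev's Thm. 1.4 in the irreducible /
additive-`p` form — VERBATIM the displayed binder `hD` (statement S2) of
`Theorems/KatoDescentTamePotSupersingularJetchevIrreducibleReadingOfStubs` (cell `bsd-potss`, crux
`JetchevIrreducibleReadingByName`, item 20165; reading audited in `Literature/…/Jetchev2008/HeegnerIndexTamagawaBoundIrreducible`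
(R1)–(R4), referee sign-off PASS, flags F1–F3 travel with it). Its binders hold on the leaf Gss2 at `3` for free:

* `Addv W 3` (leaf); `0 ≤ ord₃ j(W)` — Gss2 is potentially good (`SubGss.typeG`, `padicValRat_j_nonneg_of_typeG`);
* `W[3]` irreducible — `classX4_three_of_addv_of_subGss` (p607279);
* `3 ∤ c₃(W)` — Gss2 at `3` is Kodaira `I₀*` (`subGord_three_iff_kodairaSymbolAt_Istar_zero`), so `c₃ ∈ {1, 2, 4}`
  (Tate's algorithm Step 6, tree theorem `localTamagawaNumber_of_kodairaSymbolAt_eq_Istar_zero_holds`) — §1 below;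
* `d_{K′} ≠ −3, −4` — `3 ∣ N` splits in `K′`, `d_{K′}` odd; the conductor-`1` Kolyvagin–Heegner datum on the frame of the
  Heegner point exists (Darmon 3.6, proved) with bottom point `P` (Shimura reciprocity, proved), non-torsion with `P`.

So (§2–§3): on the mono-multiplicative-carrier, Manin-clean rank-one leaf rows U₁ ⟸ PUB + S2 + L₀, where S2 is a
READING-GRADE displayed statement shared with the potss cell (there cut further, by name, into McCallum Prop. 5.2 /
Jetchev Prop. 4.7 / Poitou–Tate + [GZ III (3.1)] in the irreducible reading: `…JetchevIrreducibleReadingDeepCut`,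
`…DivisibilityCoreVertexBridgePrimed`), instead of the research statement Σ. §4 is the RESHAPED composition of the line:
U₁ (route decl BY NAME) ⟸ PUB + S2 + Σ′ + L₀ with Σ′ = Σ asked only OFF those rows (multi-carrier rows, rows whose
Tamagawa-`3` carrier is an additive prime of type `IV`/`IV*`, rows without a `3 ∤ c` datum). The global Tamagawa binder of
S2 («every `q′ ∣ N` with `3 ∣ c_{q′}` has `q′ ∥ N`», flag F3) is part of the row, displayed.

What this is NOT: not a proof of S2 (Jetchev's Euler-system argument; XL) nor of Σ′; U₁ stays OPEN; BSD is not proved.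

References: [cite: Jetchev2008, Thm. 1.4, Cor. 1.5 (p. 812), Lemma 4.3, Rem. 6.2, Thm. 6.3] [cite: MatarNekovar2019,
Thm. 0.7 and §0.11 (pp. 456–457)] [cite: McCallumLMS1991, §5 Cor. 5.6 (p. 310)] [cite: FriedbergHoffstein1995, Thm. B]
[cite: GrossZagier1986, Thm. I.(6.3) and (7.3)] [cite: SilvermanATAEC1994, IV.9.4 Step 6 (PDF p. 345)]
[cite: Buyukboduk2008Tamagawa, §4.2] [cite: Miller2011LMS, Def. 1.1].
-/

-- D-0017: single-problem summit, so `Summit.BirchSwinnertonDyer.BirchSwinnertonDyer.…` repeats a namespace BY DESIGN.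
set_option linter.dupNamespace false
set_option autoImplicit false

noncomputable section

open scoped Classical NumberField

open WeierstrassCurve IsDedekindDomain IsDedekindDomain.HeightOneSpectrum NumberField
  Rat.HeightOneSpectrum Literature Literature.NumberTheory.EllipticCurves
  Literature.NumberTheory.EllipticCurves.ModularForms
  Literature.NumberTheory.EllipticCurves.Rank1Residual
  Literature.NumberTheory.EllipticCurves.Rank1Residual.Typed
  Literature.NumberTheory.EllipticCurves.KrizLi2019
  Literature.NumberTheory.QuadraticFields
  Summit.BirchSwinnertonDyer.Rank1Residual
  Summit.BirchSwinnertonDyer.Rank1Residual.Additive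
  Summit.BirchSwinnertonDyer.Rank1Residual.X11b.Three
  Summit.BirchSwinnertonDyer.BirchSwinnertonDyer.Theses.RamifiedHeegnerPair
  Summit.BirchSwinnertonDyer.BirchSwinnertonDyer.Theorems
  Summit.BirchSwinnertonDyer.BirchSwinnertonDyer.Theorems.SchneiderFree

namespace Summit.BirchSwinnertonDyer.BirchSwinnertonDyer.Theorems.RamifiedPairUpperBound

/-! ## §1 Leaf bookkeeping at `3`: Kodaira `I₀*`, so `3 ∤ c₃`; potentially good, so `ord₃ j ≥ 0` -/

/-- **Gss2 at `3` is Kodaira type `I₀*`**: `SubGss W 3 ⊆ SubGord W 3`, and (G-ord) at `3` is exactly `I₀*` on the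
additive locus (`subGord_three_iff_kodairaSymbolAt_Istar_zero`). [cite: SilvermanATAEC1994, IV.9.4 Step 6 (PDF p. 345)] -/
theorem kodairaSymbolAt_three_eq_Istar_zero_of_subGss (W : WeierstrassCurve ℚ) [W.IsElliptic] [W.IsGloballyMinimal]
    (hadd : Addv W 3) (hsub : SubGss W 3) : W.kodairaSymbolAt (Additive.placeOf 3) = .Istar 0 :=
  (subGord_three_iff_kodairaSymbolAt_Istar_zero W hadd).mp hsub.1

/-- **`3 ∤ c₃(E)` on the leaf Gss2 at `3`**: the fibre at `3` is `I₀*`, whose Tamagawa number is `1`, `2` or `4`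
(Tate's algorithm Step 6: `c = 1 + #{roots of the separable cubic in 𝔽₃}`; tree theorem
`localTamagawaNumber_of_kodairaSymbolAt_eq_Istar_zero_holds`, read over `ℤ₃ ⊆ ℚ₃` by `localTamagawaNumber_padic_eq_placeOf`).
This discharges, on the leaf, the one displayed local binder «`p ∤ c_p`» of the Jetchev irreducible/additive-`p` reading.
[cite: SilvermanATAEC1994, IV.9.4 Step 6 (PDF p. 345) with Rem. IV.9.3 (PDF p. 341)] -/
theorem not_three_dvd_localTamagawaNumber_three_of_subGss (W : WeierstrassCurve ℚ) [W.IsElliptic]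
    [W.IsGloballyMinimal] (hadd : Addv W 3) (hsub : SubGss W 3) :
    ¬ 3 ∣ (W.baseChange ℚ_[3]).localTamagawaNumber ℤ_[3] := by
  haveI : PerfectField (IsLocalRing.ResidueField ((Additive.placeOf 3).adicCompletionIntegers ℚ)) :=
    PerfectField.ofFinite
  have h124 := localTamagawaNumber_of_kodairaSymbolAt_eq_Istar_zero_holds (Additive.placeOf 3) W
    (kodairaSymbolAt_three_eq_Istar_zero_of_subGss W hadd hsub)
  rw [localTamagawaNumber_padic_eq_placeOf W 3]
  rcases h124 with h | h | h <;> rw [h] <;> decide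

/-- **`ord₃ j(E) ≥ 0` on the leaf Gss2 at `3`** (potentially good reduction: `SubGss.typeG` and
`padicValRat_j_nonneg_of_typeG`). [cite: SilvermanAEC2009, VII.5 Prop. 5.5] -/
theorem padicValRat_j_nonneg_of_subGss_three (W : WeierstrassCurve ℚ) [W.IsElliptic] [W.IsGloballyMinimal]
    (hadd : Addv W 3) (hsub : SubGss W 3) : 0 ≤ padicValRat 3 W.j :=
  padicValRat_j_nonneg_of_typeG W 3 (SubGss.typeG W 3 (by decide) hadd hsub)

/-! ## §2 One datum on a mono-multiplicative-carrier row: Σ at the datum IS the Jetchev reading S2 -/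

/-- **U₁ AT `W` ON A MONO-MULTIPLICATIVE-CARRIER ROW WITH A MANIN-CLEAN DATUM, from the Jetchev divisibility reading S2.**
Data: `W/ℚ` globally minimal, non-CM, leaf Gss2 at `3` (`Addv W 3`, `SubGss W 3`), `r_an(W) = 1`; a prime `q ∥ N_E`
carrying the whole `3`-part of the Tamagawa product (`ord₃ ∏_ℓ c_ℓ(E) ≤ ord₃ c_q(E)`); the global Tamagawa binder of the
reading (`htam`: every `q′ ∣ N_E` with `3 ∣ c_{q′}(E)` is multiplicative); a parametrisation datum `Dt` at level `N_E`
with `3 ∤ c(Dt)`. DISPLAYED INPUT `hD` = S2, the divisibility reading of Jetchev 2008 Thm. 1.4 at ONE multiplicative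
Tamagawa carrier `q ≠ p` for `E[p]` irreducible, `p` additive potentially good, `p ∤ c_p` — VERBATIM the binder `hD` of
`KatoDescentTamePotSupersingularJetchevIrreducibleReadingOfStubs` (cell `bsd-potss`, crux 20165), general `p`, read here at
`p = 3`. NAMED FACTS `hGZ hKo hGZK hmod hGZ73 hMN hnf hFH` (print) and the route item L₀ (`hL0`, 26023). OUTPUT:
`Typed.MissingUpperBoundAt W 3`. Proof: p610955's `leafRankOneUpper_three_of_sigmaAtDatum_of_lowerRankZero` with Σ at `Dt`
supplied by S2 — depth `ord₃ ∏c_ℓ + v₃(c) = ord₃ ∏c_ℓ ≤ ord₃ c_q`; depth `0` is free; at positive depth `3 ∣ c_q` so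
`q ≠ 3` (§1: `3 ∤ c₃`); the leaf discharges S2's binders (§1, `classX4_three_of_addv_of_subGss`); `d_{K′} ∉ {−3, −4}`
from the Heegner hypothesis at `3 ∣ N_E` and `d_{K′}` odd; the conductor-`1` datum with bottom point `P` from Darmon 3.6 /
Shimura reciprocity (tree theorems). CONDITIONAL on `hD` and the named facts; nothing asserted about any curve.
[cite: Jetchev2008, Thm. 1.4 and Cor. 1.5 (p. 812), Rem. 6.2, Thm. 6.3] [cite: MatarNekovar2019, Thm. 0.7 (p. 456) and §0.11 (p. 457)]
[cite: FriedbergHoffstein1995, Thm. B] [cite: GrossZagier1986, Thm. I.(6.3) and (7.3)] [cite: Miller2011LMS, Def. 1.1] -/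
theorem leafRankOneUpper_three_monoCarrier_of_divisibilityReading_of_lowerRankZero
    (hGZ : ∀ (N : ℕ) [NeZero N] (W : WeierstrassCurve ℚ) (K : Type) [Field K] [NumberField K],
      gross_zagier N W K)
    (hKo : ∀ (N : ℕ) [NeZero N] (W : WeierstrassCurve ℚ) (K : Type) [Field K] [NumberField K],
      kolyvagin N W K)
    (hGZK : rank_eq_analyticRank_of_analyticRank_le_one) (hmod : hasEntireLFunction_rat)
    (hGZ73 : GrossZagier1986_thm_I_7_3)
    (hMN : MatarNekovar2019.thm07_padicValNat_card_sha_primary_add_le_of_globalDivisibility_of_irreducible)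
    (hnf : exists_isNewformOf) (hFH : friedbergHoffstein_exists_heegnerField_splitDivisors_twist_ne_zero)
    (hD : ∀ (W : WeierstrassCurve ℚ) [W.IsElliptic] [W.IsGloballyMinimal] [NeZero (W.conductorNorm ℤ)],
      ¬ W.HasCM →
      ∀ (K : Type) [Field K] [NumberField K], IsImaginaryQuadratic K →
      NumberField.discr K ≠ -3 → NumberField.discr K ≠ -4 →
      SatisfiesHeegnerHypothesis (W.conductorNorm ℤ) K →
      ∀ (p : ℕ) [Fact p.Prime], p ≠ 2 → Addv W p → 0 ≤ padicValRat p W.j →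
      W.HasIrreducibleModPGaloisRep p →
      ¬ p ∣ (W.baseChange ℚ_[p]).localTamagawaNumber ℤ_[p] →
      (∀ (q' : ℕ) [Fact q'.Prime], q' ∣ W.conductorNorm ℤ →
        p ∣ (W.baseChange ℚ_[q']).localTamagawaNumber ℤ_[q'] → ¬ q' ^ 2 ∣ W.conductorNorm ℤ) →
      ∀ (Dt : ModularParametrizationData W (W.conductorNorm ℤ)) (β : ℤ) (ι : K →+* ℂ)
        (d₁ : KolyvaginHeegnerData Dt β ι 1), ¬ IsOfFinAddOrder d₁.derivedPoint →
      ∀ (q : ℕ) [Fact q.Prime], q ∣ W.conductorNorm ℤ → ¬ q ^ 2 ∣ W.conductorNorm ℤ → q ≠ p →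
      ∀ (s : ℕ), s ≤ padicValNat p ((W.baseChange ℚ_[q]).localTamagawaNumber ℤ_[q]) →
      ∀ (n : ℕ) (d : KolyvaginHeegnerData Dt β ι n), Squarefree n →
        (∀ ℓ ∈ n.primeFactors, Zhang2014.IsKolyvaginPrime (W.conductorNorm ℤ) W K p ℓ ∧
          s ≤ Zhang2014.kolyvaginIndex W p ℓ) →
        ∃ Q : (W.baseChange (ringClassField K ι n)).toAffine.Point,
          ((p ^ s : ℕ) : ℤ) • Q = d.derivedPoint)
    (hL0 : Gss2LowerAtThreeRankZero)
    (W : WeierstrassCurve ℚ) [W.IsElliptic] [W.IsGloballyMinimal] [NeZero (W.conductorNorm ℤ)]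
    (hCM : ¬ W.HasCM) (hadd : Addv W 3) (hsub : SubGss W 3) (hr : W.analyticRank = 1)
    (q : ℕ) [Fact q.Prime] (hqN : q ∣ W.conductorNorm ℤ) (hq2 : ¬ q ^ 2 ∣ W.conductorNorm ℤ)
    (hmono : padicValNat 3 W.tamagawaProduct ≤ padicValNat 3 ((W.baseChange ℚ_[q]).localTamagawaNumber ℤ_[q]))
    (htam : ∀ (q' : ℕ) [Fact q'.Prime], q' ∣ W.conductorNorm ℤ →
      3 ∣ (W.baseChange ℚ_[q']).localTamagawaNumber ℤ_[q'] → ¬ q' ^ 2 ∣ W.conductorNorm ℤ)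
    (Dt : ModularParametrizationData W (W.conductorNorm ℤ)) (hc : ¬ (3 : ℤ) ∣ Dt.c) :
    MissingUpperBoundAt W 3 := by
  -- the leaf discharges the reading's local binders at `p = 3`
  have hirr : W.HasIrreducibleModPGaloisRep 3 := (classX4_three_of_addv_of_subGss W hadd hsub).2.2
  have hj : 0 ≤ padicValRat 3 W.j := padicValRat_j_nonneg_of_subGss_three W hadd hsub
  have hc3 : ¬ 3 ∣ (W.baseChange ℚ_[3]).localTamagawaNumber ℤ_[3] :=
    not_three_dvd_localTamagawaNumber_three_of_subGss W hadd hsub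
  have h3N : 3 ∣ W.conductorNorm ℤ :=
    (W.dvd_conductorNorm_iff_not_hasGoodReductionAtPrime 3).mpr (not_good_of_addv W 3 hadd)
  have hc0 : padicValNat 3 Dt.c.natAbs = 0 :=
    padicValNat.eq_zero_of_not_dvd fun h ↦ hc (Int.ofNat_dvd_left.mpr h)
  refine leafRankOneUpper_three_of_sigmaAtDatum_of_lowerRankZero hGZ hKo hGZK hmod hGZ73 hMN hnf hFH hL0 W hCM hadd
    hsub hr Dt ?_
  intro K _ _ H ι P hK hHN hLt hP hnt hodd s' hs' n d hn hℓ
  -- depth `0` is free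
  rcases Nat.eq_zero_or_pos s' with hs0 | hspos
  · subst hs0
    exact koly_pDiv_zero d 3
  -- positive depth: `3 ∣ c_q`, so the carrier `q` is not `3`
  have hsq : s' ≤ padicValNat 3 ((W.baseChange ℚ_[q]).localTamagawaNumber ℤ_[q]) := by omega
  have hq3 : q ≠ 3 := by
    rintro rfl
    have hpos : 0 < padicValNat 3 ((W.baseChange ℚ_[3]).localTamagawaNumber ℤ_[3]) := by omega
    exact hc3 (dvd_of_one_le_padicValNat hpos)
  -- `d_K ∉ {-3, -4}`: `3 ∣ N_E` splits in `K`, `d_K` odd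
  have h3 : NumberField.discr K ≠ -3 := by
    intro h
    exact (X11b.Three.not_dvd_discr_and_not_dvd_torsionOrder_of_heegner hK hHN (by decide) h3N).1
      (h ▸ ⟨-1, by norm_num⟩)
  have h4 : NumberField.discr K ≠ -4 := by
    intro h
    rw [h] at hodd
    exact (Int.not_odd_iff_even.mpr ⟨-2, by norm_num⟩) hodd
  -- the conductor-`1` Kolyvagin–Heegner datum on the frame, with bottom point `P` (Darmon 3.6 / Shimura, proved)
  obtain ⟨d₁⟩ := exists_kolyvaginHeegnerData_one
    (phi_heegnerTau_mem_singularModuliField_holds (W.conductorNorm ℤ) W K) hK Dt H.β ι H.dvd_sq_sub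
  have hPd : d₁.toGeomPoints d₁.derivedPoint = toGeomPoints (W.baseChange K) P :=
    X11b.KolyvaginBottom.toGeomPoints_derivedPoint_one_eq
      (heegnerPointOfConductor_one_galoisConj_holds (W.conductorNorm ℤ) W K) hK hHN hP d₁ rfl
  have hy₁ : ¬ IsOfFinAddOrder d₁.derivedPoint := by
    intro hfin
    apply hnt
    have h1 : IsOfFinAddOrder (d₁.toGeomPoints d₁.derivedPoint) := d₁.toGeomPoints.isOfFinAddOrder hfin
    rw [hPd] at h1
    exact (toGeomPoints_injective (W.baseChange K)).isOfFinAddOrder_iff.mp h1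
  -- S2 at `p = 3`, carrier `q`, depth `s'`
  exact hD W hCM K hK h3 h4 hHN 3 (by decide) hadd hj hirr hc3 htam Dt H.β ι d₁ hy₁ q hqN hq2 hq3 s' hsq n d hn hℓ


/-! ## §3 The mono-multiplicative-carrier, Manin-clean rank-one leaf rows: U₁ ⟸ PUB + S2 + L₀ -/

/-- **U₁ ON THE MONO-MULTIPLICATIVE-CARRIER, MANIN-CLEAN ROWS from PUB + S2 + L₀.** For every non-CM leaf curve `W`
(`Addv W 3`, `SubGss W 3`) of analytic rank one such that (ROW) some prime `q ∥ N_E` carries the whole `3`-part of the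
Tamagawa product (`ord₃ ∏_ℓ c_ℓ(E) ≤ ord₃ c_q(E)`), every `q′ ∣ N_E` with `3 ∣ c_{q′}(E)` is multiplicative (the reading's
global binder, flag F3: no additive Tamagawa-`3` carrier of type `IV`/`IV*`), and a parametrisation datum at level `N_E`
with `3 ∤ c` exists: `Typed.MissingUpperBoundAt W 3` follows from the printed named facts, the displayed reading S2 (`hD`,
VERBATIM the potss binder) and the route item L₀ (26023). On these rows the open core Σ of line `splitkolyvagin` is
therefore READING-GRADE (Jetchev 2008 Thm. 1.4 in the audited irreducible/additive-`p` reading), not research; the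
Tamagawa-free rows (p610955 §3) are the sub-case `ord₃ c_q = 0`. CONDITIONAL on `hD` and the named facts; nothing
asserted about any curve; BSD is not proved. [cite: Jetchev2008, Thm. 1.4 and Cor. 1.5 (p. 812)]
[cite: MatarNekovar2019, Thm. 0.7 (p. 456) and §0.11 (p. 457)] [cite: FriedbergHoffstein1995, Thm. B]
[cite: GrossZagier1986, Thm. I.(6.3) and (7.3)] [cite: Miller2011LMS, Def. 1.1] -/
theorem leafRankOneUpper_three_onMonoCarrierRows_of_divisibilityReading_of_lowerRankZero
    (hGZ : ∀ (N : ℕ) [NeZero N] (W : WeierstrassCurve ℚ) (K : Type) [Field K] [NumberField K],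
      gross_zagier N W K)
    (hKo : ∀ (N : ℕ) [NeZero N] (W : WeierstrassCurve ℚ) (K : Type) [Field K] [NumberField K],
      kolyvagin N W K)
    (hGZK : rank_eq_analyticRank_of_analyticRank_le_one) (hmod : hasEntireLFunction_rat)
    (hGZ73 : GrossZagier1986_thm_I_7_3)
    (hMN : MatarNekovar2019.thm07_padicValNat_card_sha_primary_add_le_of_globalDivisibility_of_irreducible)
    (hnf : exists_isNewformOf) (hFH : friedbergHoffstein_exists_heegnerField_splitDivisors_twist_ne_zero)
    (hD : ∀ (W : WeierstrassCurve ℚ) [W.IsElliptic] [W.IsGloballyMinimal] [NeZero (W.conductorNorm ℤ)],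
      ¬ W.HasCM →
      ∀ (K : Type) [Field K] [NumberField K], IsImaginaryQuadratic K →
      NumberField.discr K ≠ -3 → NumberField.discr K ≠ -4 →
      SatisfiesHeegnerHypothesis (W.conductorNorm ℤ) K →
      ∀ (p : ℕ) [Fact p.Prime], p ≠ 2 → Addv W p → 0 ≤ padicValRat p W.j →
      W.HasIrreducibleModPGaloisRep p →
      ¬ p ∣ (W.baseChange ℚ_[p]).localTamagawaNumber ℤ_[p] →
      (∀ (q' : ℕ) [Fact q'.Prime], q' ∣ W.conductorNorm ℤ →
        p ∣ (W.baseChange ℚ_[q']).localTamagawaNumber ℤ_[q'] → ¬ q' ^ 2 ∣ W.conductorNorm ℤ) →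
      ∀ (Dt : ModularParametrizationData W (W.conductorNorm ℤ)) (β : ℤ) (ι : K →+* ℂ)
        (d₁ : KolyvaginHeegnerData Dt β ι 1), ¬ IsOfFinAddOrder d₁.derivedPoint →
      ∀ (q : ℕ) [Fact q.Prime], q ∣ W.conductorNorm ℤ → ¬ q ^ 2 ∣ W.conductorNorm ℤ → q ≠ p →
      ∀ (s : ℕ), s ≤ padicValNat p ((W.baseChange ℚ_[q]).localTamagawaNumber ℤ_[q]) →
      ∀ (n : ℕ) (d : KolyvaginHeegnerData Dt β ι n), Squarefree n →
        (∀ ℓ ∈ n.primeFactors, Zhang2014.IsKolyvaginPrime (W.conductorNorm ℤ) W K p ℓ ∧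
          s ≤ Zhang2014.kolyvaginIndex W p ℓ) →
        ∃ Q : (W.baseChange (ringClassField K ι n)).toAffine.Point,
          ((p ^ s : ℕ) : ℤ) • Q = d.derivedPoint)
    (hL0 : Gss2LowerAtThreeRankZero)
    (W : WeierstrassCurve ℚ) [W.IsElliptic] [W.IsGloballyMinimal] [NeZero (W.conductorNorm ℤ)]
    (hCM : ¬ W.HasCM) (hadd : Addv W 3) (hsub : SubGss W 3) (hr : W.analyticRank = 1)
    (hrow : ((∃ (q : ℕ) (_ : Fact q.Prime), q ∣ W.conductorNorm ℤ ∧ ¬ q ^ 2 ∣ W.conductorNorm ℤ ∧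
          padicValNat 3 W.tamagawaProduct ≤ padicValNat 3 ((W.baseChange ℚ_[q]).localTamagawaNumber ℤ_[q])) ∧
        (∀ (q' : ℕ) [Fact q'.Prime], q' ∣ W.conductorNorm ℤ →
          3 ∣ (W.baseChange ℚ_[q']).localTamagawaNumber ℤ_[q'] → ¬ q' ^ 2 ∣ W.conductorNorm ℤ) ∧
        (∃ Dt' : Literature.NumberTheory.EllipticCurves.ModularForms.ModularParametrizationData W (W.conductorNorm ℤ), ¬ (3 : ℤ) ∣ Dt'.c))) :
    MissingUpperBoundAt W 3 := by
  obtain ⟨⟨q, _, hqN, hq2, hmono⟩, htam, ⟨Dt, hc⟩⟩ := hrow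
  exact leafRankOneUpper_three_monoCarrier_of_divisibilityReading_of_lowerRankZero hGZ hKo hGZK hmod hGZ73 hMN hnf hFH
    hD hL0 W hCM hadd hsub hr q hqN hq2 hmono htam Dt hc

/-! ## §4 The reshaped composition of the line: U₁ ⟸ PUB + S2 + Σ′ + L₀ (Σ′ = Σ asked only OFF the rows of §3) -/

/-- **`LeafRankOneUpperAtThree` ⟸ PUB + S2 + Σ′ + L₀** (conclusion literally the route decl; skeleton v3 of line
`splitkolyvagin`). PUB = the registered print conjunction (unchanged); S2 = the Jetchev divisibility reading in the
irreducible/additive-`p` form (VERBATIM the potss binder `hD`, displayed, reading-grade); Σ′ = the registered Σ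
(`stub_leafSigmaDivisibilityAtThree`) with ONE extra binder «`W` is NOT on a mono-multiplicative-carrier Manin-clean row»
(so Σ′ is asked only on multi-carrier rows, rows whose Tamagawa-`3` carrier is additive of type `IV`/`IV*`, and rows
with no `3 ∤ c` datum — the research residue); L₀ = route item 26023 BY NAME. Case split on the row predicate: on the
rows §3, off the rows p610955's `leafRankOneUpper_three_of_sigmaAtDatum_of_lowerRankZero` with Σ′ at the datum of
`nonempty_modularParametrizationData`. CONDITIONAL on every displayed input; U₁ stays OPEN; BSD is not proved.
[cite: Jetchev2008, Conj. 1.3, Thm. 1.4 (p. 812)] [cite: MatarNekovar2019, Thm. 0.7 (p. 456)]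
[cite: FriedbergHoffstein1995, Thm. B] [cite: GrossZagier1986, Thm. I.(6.3) and (7.3)] [cite: Miller2011LMS, Def. 1.1] -/
theorem leafRankOneUpperAtThree_of_pub_of_divisibilityReading_of_sigmaOffRows_of_lowerRankZero
    (hpub : (∀ (N : ℕ) [NeZero N] (W : WeierstrassCurve ℚ) (K : Type) [Field K] [NumberField K],
        Literature.NumberTheory.EllipticCurves.gross_zagier N W K) ∧
      (∀ (N : ℕ) [NeZero N] (W : WeierstrassCurve ℚ) (K : Type) [Field K] [NumberField K],
        Literature.NumberTheory.EllipticCurves.kolyvagin N W K) ∧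
      Literature.NumberTheory.EllipticCurves.rank_eq_analyticRank_of_analyticRank_le_one ∧
      WeierstrassCurve.hasEntireLFunction_rat ∧
      Literature.NumberTheory.EllipticCurves.GrossZagier1986_thm_I_7_3 ∧
      Literature.NumberTheory.EllipticCurves.MatarNekovar2019.thm07_padicValNat_card_sha_primary_add_le_of_globalDivisibility_of_irreducible ∧
      Literature.NumberTheory.EllipticCurves.ModularForms.exists_isNewformOf ∧
      Literature.NumberTheory.EllipticCurves.friedbergHoffstein_exists_heegnerField_splitDivisors_twist_ne_zero ∧
      Literature.NumberTheory.EllipticCurves.ModularForms.nonempty_modularParametrizationData)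
    (hD : ∀ (W : WeierstrassCurve ℚ) [W.IsElliptic] [W.IsGloballyMinimal] [NeZero (W.conductorNorm ℤ)],
      ¬ W.HasCM →
      ∀ (K : Type) [Field K] [NumberField K], IsImaginaryQuadratic K →
      NumberField.discr K ≠ -3 → NumberField.discr K ≠ -4 →
      SatisfiesHeegnerHypothesis (W.conductorNorm ℤ) K →
      ∀ (p : ℕ) [Fact p.Prime], p ≠ 2 → Addv W p → 0 ≤ padicValRat p W.j →
      W.HasIrreducibleModPGaloisRep p →
      ¬ p ∣ (W.baseChange ℚ_[p]).localTamagawaNumber ℤ_[p] →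
      (∀ (q' : ℕ) [Fact q'.Prime], q' ∣ W.conductorNorm ℤ →
        p ∣ (W.baseChange ℚ_[q']).localTamagawaNumber ℤ_[q'] → ¬ q' ^ 2 ∣ W.conductorNorm ℤ) →
      ∀ (Dt : ModularParametrizationData W (W.conductorNorm ℤ)) (β : ℤ) (ι : K →+* ℂ)
        (d₁ : KolyvaginHeegnerData Dt β ι 1), ¬ IsOfFinAddOrder d₁.derivedPoint →
      ∀ (q : ℕ) [Fact q.Prime], q ∣ W.conductorNorm ℤ → ¬ q ^ 2 ∣ W.conductorNorm ℤ → q ≠ p →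
      ∀ (s : ℕ), s ≤ padicValNat p ((W.baseChange ℚ_[q]).localTamagawaNumber ℤ_[q]) →
      ∀ (n : ℕ) (d : KolyvaginHeegnerData Dt β ι n), Squarefree n →
        (∀ ℓ ∈ n.primeFactors, Zhang2014.IsKolyvaginPrime (W.conductorNorm ℤ) W K p ℓ ∧
          s ≤ Zhang2014.kolyvaginIndex W p ℓ) →
        ∃ Q : (W.baseChange (ringClassField K ι n)).toAffine.Point,
          ((p ^ s : ℕ) : ℤ) • Q = d.derivedPoint)
    (hSig' : ∀ (W : WeierstrassCurve ℚ) [W.IsElliptic] [W.IsGloballyMinimal] (N : ℕ) [NeZero N]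
      (K : Type) [Field K] [NumberField K]
      (Dt : Literature.NumberTheory.EllipticCurves.ModularForms.ModularParametrizationData W N)
      (H : Literature.NumberTheory.EllipticCurves.HeegnerDatum N (NumberField.discr K)) (ι : K →+* ℂ)
      (P : (W.baseChange K).toAffine.Point),
      ¬ W.HasCM → Literature.NumberTheory.EllipticCurves.Rank1Residual.Addv W 3 →
      Summit.BirchSwinnertonDyer.Rank1Residual.Additive.SubGss W 3 → W.analyticRank = 1 →
      W.conductorNorm ℤ = N →
      ¬ ((∃ (q : ℕ) (_ : Fact q.Prime), q ∣ N ∧ ¬ q ^ 2 ∣ N ∧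
          padicValNat 3 W.tamagawaProduct ≤ padicValNat 3 ((W.baseChange ℚ_[q]).localTamagawaNumber ℤ_[q])) ∧
        (∀ (q' : ℕ) [Fact q'.Prime], q' ∣ N →
          3 ∣ (W.baseChange ℚ_[q']).localTamagawaNumber ℤ_[q'] → ¬ q' ^ 2 ∣ N) ∧
        (∃ Dt' : Literature.NumberTheory.EllipticCurves.ModularForms.ModularParametrizationData W N, ¬ (3 : ℤ) ∣ Dt'.c)) →
      Literature.NumberTheory.EllipticCurves.IsImaginaryQuadratic K →
      Literature.NumberTheory.EllipticCurves.SatisfiesHeegnerHypothesis N K →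
      (W.quadraticTwist (NumberField.discr K : ℚ)).entireLFunction 1 ≠ 0 →
      (WeierstrassCurve.Affine.Point.map ι.toRatAlgHom) P =
        Literature.NumberTheory.EllipticCurves.ModularForms.heegnerPointComplex Dt H →
      ¬ IsOfFinAddOrder P → Odd (NumberField.discr K) →
      ∀ (s' : ℕ), s' ≤ padicValNat 3 W.tamagawaProduct + padicValNat 3 Dt.c.natAbs →
      ∀ (n : ℕ) (d : Literature.NumberTheory.EllipticCurves.KolyvaginHeegnerData Dt H.β ι n), Squarefree n →
      (∀ ℓ ∈ n.primeFactors, Literature.NumberTheory.EllipticCurves.Zhang2014.IsKolyvaginPrime N W K 3 ℓ ∧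
        s' ≤ Literature.NumberTheory.EllipticCurves.Zhang2014.kolyvaginIndex W 3 ℓ) →
      Summit.BirchSwinnertonDyer.Rank1Residual.X11b.Three.Koly.PDiv d 3 s')
    (hL0 : Summit.BirchSwinnertonDyer.BirchSwinnertonDyer.Theses.RamifiedHeegnerPair.Gss2LowerAtThreeRankZero) :
    Summit.BirchSwinnertonDyer.BirchSwinnertonDyer.Theses.RamifiedHeegnerPair.LeafRankOneUpperAtThree := by
  intro W _ _ hCM hadd hsub hr
  obtain ⟨hGZ, hKo, hGZK, hmod, hGZ73, hMN, hnf, hFH, hMP⟩ := hpub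
  haveI : NeZero (W.conductorNorm ℤ) := ⟨(Nat.pos_iff_ne_zero.mp W.conductorNorm_pos_holds)⟩
  by_cases hrow : ((∃ (q : ℕ) (_ : Fact q.Prime), q ∣ W.conductorNorm ℤ ∧ ¬ q ^ 2 ∣ W.conductorNorm ℤ ∧
          padicValNat 3 W.tamagawaProduct ≤ padicValNat 3 ((W.baseChange ℚ_[q]).localTamagawaNumber ℤ_[q])) ∧
        (∀ (q' : ℕ) [Fact q'.Prime], q' ∣ W.conductorNorm ℤ →
          3 ∣ (W.baseChange ℚ_[q']).localTamagawaNumber ℤ_[q'] → ¬ q' ^ 2 ∣ W.conductorNorm ℤ) ∧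
        (∃ Dt' : Literature.NumberTheory.EllipticCurves.ModularForms.ModularParametrizationData W (W.conductorNorm ℤ), ¬ (3 : ℤ) ∣ Dt'.c))
  · exact leafRankOneUpper_three_onMonoCarrierRows_of_divisibilityReading_of_lowerRankZero hGZ hKo hGZK hmod hGZ73
      hMN hnf hFH hD hL0 W hCM hadd hsub hr hrow
  · obtain ⟨Dt⟩ := hMP W
    exact leafRankOneUpper_three_of_sigmaAtDatum_of_lowerRankZero hGZ hKo hGZK hmod hGZ73 hMN hnf hFH hL0 W hCM hadd
      hsub hr Dt (fun K _ _ H ι P hK hHN hLt hP hnt hodd s' hs' n d hn hℓ ↦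
        hSig' W (W.conductorNorm ℤ) K Dt H ι P hCM hadd hsub hr rfl hrow hK hHN hLt hP hnt hodd s' hs' n d hn hℓ)

end Summit.BirchSwinnertonDyer.BirchSwinnertonDyer.Theorems.RamifiedPairUpperBound

end
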